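import Summits.NavierStokesRegularity.NavierStokesRegularity.Theses.PumpContinuation
import Summits.NavierStokesRegularity.NavierStokesRegularity.Theses.DssFarFieldSlaving
import Summits.NavierStokesRegularity.NavierStokesRegularity.Theorems.DssFarFieldSlavingDssTruncationBridge
import Summits.NavierStokesRegularity.NavierStokesRegularity.Theorems.PumpContinuationMildBlowupClassical
import Summits.NavierStokesRegularity.NavierStokesRegularity.Theorems.PumpContinuationEulerProximatePumpDoorOfDssProfile
import Summits.NavierStokesRegularity.NavierStokesRegularity.Theorems.PumpContinuationEulerProximatePumpTransfer

/-!
# Evidence (line lead c10, crux `EulerProximatePump`, stmt-NavierStokesRegularity-18302): both lines are DOMINATED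

Kernel-checked bookkeeping behind the `line-dead` verdicts for lines `SketchIdeator2` and `Sketch`:

* `blowupTypeIDssProfile_refutes_clay` — the ONLY open stub of line `SketchIdeator2`
  (`stub_blowupTypeIDssProfile` = item stmt-0155 = `Theses.DssFarFieldSlaving.BlowupTypeIDssProfile`)
  ALREADY refutes `NavierStokesRegularity` by itself, through route DssFarFieldSlaving's deciding theorem
  `closes` and its PROVED crux `DssTruncationBridge` (stmt-14477, `dssTruncationBridge_proof`). So the day the
  stub closes, the summit's negative side closes WITHOUT the Door, without `BoundedTemperatureClosed` and without
  route PumpContinuation: the line can never be on the critical path.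
* `nsTypeIMildBlowup_refutes_clay` — the intermediate object of BOTH lines (a Schwartz-data `H¹⁰_df`-mild Type-I
  blow-up of the true Navier–Stokes form with no mild extension, "NSTypeI") also refutes `NavierStokesRegularity`
  by itself (proved support `MildBlowupClassical` + `Literature.NS.blowup_assembly` + proved X5b).
* `door_of_stub_and_moot` — what line `SketchIdeator2` delivers from its stub: the Door AND, independently, `¬` Clay (A).

Nothing here is new mathematics; it is the composition of accepted tree theorems, recorded so that the verdict
"dominated line" is checkable. Not proposed to `Theorems/` (it proves no registered stub and closes no item).
-/

noncomputable section

set_option linter.dupNamespace false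

open MeasureTheory Set Filter
open scoped ENNReal
open Literature.Analysis.FluidPDE Literature.Analysis.FluidPDE.Tao2016

namespace Summit.NavierStokesRegularity.NavierStokesRegularity.Cruxes.EulerProximatePump.LeadC10

open Summit.NavierStokesRegularity.NavierStokesRegularity.Theses
open Summit.NavierStokesRegularity.NavierStokesRegularity.Theorems

/-- **The open stub of line `SketchIdeator2` already decides the summit (negatively) on its own.**
`BlowupTypeIDssProfile → ¬ NavierStokesRegularity`, by route DssFarFieldSlaving's `closes` with its proved
crux `DssTruncationBridge` (stmt-14477). [folklore] -/
theorem blowupTypeIDssProfile_refutes_clay (hP : DssFarFieldSlaving.BlowupTypeIDssProfile) :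
    ¬ _root_.NavierStokesRegularity :=
  DssFarFieldSlaving.closes dssTruncationBridge_proof hP

/-- **NSTypeI already decides the summit (negatively) on its own**: a Schwartz-data `H¹⁰_df`-mild Type-I
blow-up of the Navier–Stokes form `B` with no mild extension refutes Clay (A) — proved support
`MildBlowupClassical` (stmt-18304), `Literature.NS.blowup_assembly`, proved X5b `blowup_clay_uniqueness`.
(The Type-I rate is not even used.) [folklore] -/
theorem nsTypeIMildBlowup_refutes_clay
    (h : ∃ M : ℝ, ∃ u₀ : SchwartzMap (EuclideanSpace ℝ (Fin 3)) (EuclideanSpace ℝ (Fin 3)),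
      VectorCalculus.IsDivFree ⇑u₀ ∧ ∃ S : ℝ, 0 < S ∧ ∃ u : ℝ → L2C,
        IsMildSolutionFor eulerForm (schwartzL2 u₀) (Ico 0 S) u ∧
        (∀ t ∈ Ico 0 S, eLpNorm (u t) ⊤ volume ≤ ENNReal.ofReal (M / Real.sqrt (S - t))) ∧
        ¬ ∃ S' : ℝ, S < S' ∧ ∃ v : ℝ → L2C,
          IsMildSolutionFor eulerForm (schwartzL2 u₀) (Ico 0 S') v ∧ ∀ t ∈ Ico 0 S, v t = u t) :
    ¬ _root_.NavierStokesRegularity := by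
  obtain ⟨-, u₀, hdiv, S, hS, u, hmild, -, hno⟩ := h
  obtain ⟨T, hT, w, p, hmax, hLH, hdec⟩ := pumpContinuation_mildBlowupClassical_proof u₀ hdiv S hS u hmild hno
  exact Literature.NS.blowup_assembly ⟨⟨1, one_pos, T, hT, w, p, hmax, hLH, hdec⟩, blowup_clay_uniqueness⟩

/-- **What line `SketchIdeator2` delivers from its one open stub**: the Door (landed conditional closing
`eulerProximatePump_of_blowupTypeIDssProfile`, p152401) — and, bypassing the Door and the whole route,
`¬ NavierStokesRegularity`. The line is dominated. [folklore] -/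
theorem door_of_stub_and_moot (hP : DssFarFieldSlaving.BlowupTypeIDssProfile) :
    PumpContinuation.EulerProximatePump ∧ ¬ _root_.NavierStokesRegularity :=
  ⟨eulerProximatePump_of_blowupTypeIDssProfile hP, blowupTypeIDssProfile_refutes_clay hP⟩

/-- **The intermediate of both lines is NSTypeI, which gives the Door for free** (`𝒜 := euler`; landed
`pumpContinuation_eulerProximatePump_of_nsTypeI`, p146155) **and moots it** (`nsTypeIMildBlowup_refutes_clay`). [folklore] -/
theorem door_of_nsTypeI_and_moot
    (h : ∃ M : ℝ, ∃ u₀ : SchwartzMap (EuclideanSpace ℝ (Fin 3)) (EuclideanSpace ℝ (Fin 3)),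
      VectorCalculus.IsDivFree ⇑u₀ ∧ ∃ S : ℝ, 0 < S ∧ ∃ u : ℝ → L2C,
        IsMildSolutionFor eulerForm (schwartzL2 u₀) (Ico 0 S) u ∧
        (∀ t ∈ Ico 0 S, eLpNorm (u t) ⊤ volume ≤ ENNReal.ofReal (M / Real.sqrt (S - t))) ∧
        ¬ ∃ S' : ℝ, S < S' ∧ ∃ v : ℝ → L2C,
          IsMildSolutionFor eulerForm (schwartzL2 u₀) (Ico 0 S') v ∧ ∀ t ∈ Ico 0 S, v t = u t) :
    PumpContinuation.EulerProximatePump ∧ ¬ _root_.NavierStokesRegularity :=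
  ⟨pumpContinuation_eulerProximatePump_of_nsTypeI h, nsTypeIMildBlowup_refutes_clay h⟩

end Summit.NavierStokesRegularity.NavierStokesRegularity.Cruxes.EulerProximatePump.LeadC10

end
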